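import Literature.AlgebraicGeometry.HodgeTheory.AnalytificationImmersivePoint
import Literature.AlgebraicGeometry.Motives.AlgPointsProperProofs
import Literature.AlgebraicGeometry.Motives.HypersurfaceFieldPoints
import Literature.NumberTheory.Transcendental.AnalytificationProjProofs
import Literature.NumberTheory.Transcendental.AnalytificationSeparatedProofs
import HarnessLib

/-!
# Route `SecondaryPeriods` — crux `RiemannWeightOne` (stmt-HodgeConjecture-16406), line `birth`: stub `stub_algebraisation`

The registered stub `stub_algebraisation` of the line skeleton
`Summits/HodgeConjecture/HodgeConjecture/Cruxes/RiemannWeightOne/Lines/birth.lean`, proved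
unconditionally: **a projective algebraic set which is the injective holomorphic image of a compact
complex manifold carries the reduced closed subscheme of `ℙᴺ_ℂ`, and the manifold is its
analytification.**

**Statement.** Let `M` be a compact complex manifold (model `ℂⁿ`) and `F : M → ℙᴺ(ℂ)` injective and
holomorphic with `range F` projective algebraic (`IsProjAlgebraicSet`, e.g. by Chow's theorem). Then
there are a REDUCED closed subscheme `ι : X ↪ ℙᴺ_ℂ` and a map `φ : M → X(ℂ)` over `F`
(`ι(ℂ) ∘ φ = projPoint ∘ F`) which is an analytification of `X`
(`Literature.NumberTheory.Transcendental.IsAnalytification`): a homeomorphism onto `X(ℂ)` with its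
strong topology along which regular functions on affine opens of `X` pull back to holomorphic
functions on `M`.

**Proof** (Serre, GAGA §2 n°5, p. 9: «si `Y` est un sous-ensemble Z-localement fermé dans `X`, … la
structure analytique de `Y^h` coïncide avec la structure analytique induite sur `Y` par `X^h`»;
Hartshorne II Example 3.2.6 and Ex. 3.11 (d) for the reduced induced structure).

1. `range F = V(S)` for a finite set `S` of homogeneous forms; the Zariski-closed set
   `Z = ⋂_{G ∈ S} ℙᴺ ∖ D₊(G)` of `ℙᴺ_ℂ = Proj ℂ[x₀, …, x_N]` satisfies
   `p ∈ V(S) ↔ projPoint p ∈ Z(ℂ)` (`preimage_projPoint_setOf_pt_mem_basicOpen`;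
   `exists_isClosed_mem_projZeroLocus_iff`).
2. `X` is the reduced induced closed subscheme on `Z` (Mathlib
   `Scheme.IdealSheafData.vanishingIdeal … |>.subscheme`), made into a `ℂ`-scheme; it is reduced
   because its affine pieces are spectra of quotients by radical ideals
   (`exists_isClosedImmersion_isReduced_range_eq`).
3. `X(ℂ) = {Q ∈ ℙᴺ(ℂ) | Q ∈ Z}`: a complex point of `ℙᴺ` on `Z` factors through the reduced closed
   subscheme (`AlgPoints.liftClosed`, the universal property of the reduced induced structure for
   the reduced source `Spec ℂ`; `range_map_of_isClosedImmersion`).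
4. Hence `ι(ℂ)(X(ℂ)) = projPoint (F(M))`, and `φ := ι(ℂ)⁻¹ ∘ projPoint ∘ F` is a bijection
   `M → X(ℂ)`; it is continuous because `ι(ℂ)` is a closed embedding (`X` is proper, so `X(ℂ)` is
   compact, `compactSpace_algPoints_of_isProper_holds`; `ℙᴺ_ℂ(ℂ)` is Hausdorff), hence a
   homeomorphism (`M` compact, `X(ℂ)` Hausdorff).
5. Holomorphy of pulled-back regular functions: a closed immersion is surjective on stalks, so a
   regular function `s` near `φ m₀` agrees, on the complex points of a Zariski neighbourhood, with
   `r ∘ ι` for a regular function `r` on an affine open of `ℙᴺ`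
   (`HodgeTheory.exists_eval_eq_of_stalkMap_surjective`); and `r ∘ projPoint ∘ F` is holomorphic
   (`isAnalytification_projPoint`: regular functions on `ℙᴺ` are holomorphic on `ℙᴺ(ℂ)`, composed
   with the holomorphic `F`). This is `exists_isAnalytification_of_range_map_eq`.

## References

* [SerreGAGA1956] J.-P. Serre, Géométrie algébrique et géométrie analytique, Ann. Inst. Fourier 6
  (1956), §2 n°5 (Lemme 1, Prop. 2, and p. 9), n°7 Prop. 6.
* [Hartshorne1977] R. Hartshorne, Algebraic Geometry, GTM 52 (1977), II Example 3.2.6, II Ex. 2.7,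
  II Ex. 3.11 (d), II §2 (stalks of morphisms).
-/

noncomputable section

-- every declaration of this problem lives in `Summit.HodgeConjecture.HodgeConjecture.…`
set_option linter.dupNamespace false

namespace Summit.HodgeConjecture.HodgeConjecture.Theorems.RiemannWeightOne

open scoped Manifold ContDiff LinearAlgebra.Projectivization Topology
open CategoryTheory AlgebraicGeometry TopologicalSpace
open Literature.AlgebraicGeometry.Motives
open Literature.NumberTheory.Transcendental (IsAnalytification IsProjAlgebraicSet projPoint
  projPoint_injective projPoint_surjective continuous_projPoint
  mdifferentiableOn_evalOrZero_projPoint preimage_projPoint_setOf_pt_mem_basicOpen)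
open Projectivization (projZeroLocus)

universe u

/-! ### Complex points of closed subschemes; the reduced induced closed subscheme -/

section ClosedSubscheme

variable {k : Type u} [Field k] {L : Type u} [Field L] [Algebra k L]

/-- **`X(L) = {Q ∈ Y(L) | Q lies on X}` for a closed `k`-immersion `ι : X ↪ Y`**: the image of
`ι(L) : X(L) → Y(L)` is the set of `L`-points of `Y` whose underlying point lies on `ι(X)` (an
`L`-point on `ι(X)` factors through the closed subscheme since `Spec L` is reduced,
`AlgPoints.liftClosed`). [cite: Hartshorne1977, II Ex. 2.7 and II Ex. 3.11 (d)] -/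
theorem range_map_of_isClosedImmersion {X Y : SchemeOver k} (ι : X ⟶ Y) [IsClosedImmersion ι.left] :
    Set.range (AlgPoints.map ι : AlgPoints X L → AlgPoints Y L) = {Q | Q.pt ∈ Set.range ι.left} := by
  ext Q
  constructor
  · rintro ⟨Q', rfl⟩
    exact AlgPoints.pt_map_mem_range ι Q'
  · intro hQ
    exact ⟨Q.liftClosed ι hQ, AlgPoints.map_liftClosed ι Q hQ⟩

/-- **The reduced induced closed subscheme on a closed subset, as a `k`-scheme.** For a `k`-scheme
`Y` and a closed subset `Z ⊆ Y` there is a reduced `k`-scheme `X` with a closed `k`-immersion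
`ι : X ↪ Y` of image `Z`: the closed subscheme of the vanishing ideal sheaf of `Z` (Mathlib
`Scheme.IdealSheafData.vanishingIdeal`, `subschemeι`), reduced because its affine pieces are the
spectra of the quotients `Γ(U, 𝒪_Y)/I(Z ∩ U)` by radical ideals.
[cite: Hartshorne1977, II Example 3.2.6] -/
theorem exists_isClosedImmersion_isReduced_range_eq (Y : SchemeOver k) {Z : Set Y.left}
    (hZ : IsClosed Z) :
    ∃ (X : SchemeOver k) (ι : X ⟶ Y) (_ : IsClosedImmersion ι.left) (_ : IsReduced X.left),
      Set.range ι.left = Z := by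
  refine ⟨Over.mk ((Scheme.IdealSheafData.vanishingIdeal ⟨Z, hZ⟩).subschemeι ≫ Y.hom),
    Over.homMk (Scheme.IdealSheafData.vanishingIdeal ⟨Z, hZ⟩).subschemeι rfl,
    (inferInstance : IsClosedImmersion (Scheme.IdealSheafData.vanishingIdeal ⟨Z, hZ⟩).subschemeι),
    ?_, ?_⟩
  · -- adapted from `Literature.AlgebraicGeometry.Motives.AbelianVariety.isReduced_redSubOver_left`
    change IsReduced (Scheme.IdealSheafData.vanishingIdeal ⟨Z, hZ⟩).subscheme
    haveI : ∀ U, IsReduced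
        ((Scheme.IdealSheafData.vanishingIdeal ⟨Z, hZ⟩).subschemeCover.openCover.X U) := by
      intro (U : Y.left.affineOpens)
      change IsReduced (Spec (.of (Γ(Y.left, (U : Y.left.Opens)) ⧸
        (Scheme.IdealSheafData.vanishingIdeal ⟨Z, hZ⟩).ideal U)))
      haveI : _root_.IsReduced (Γ(Y.left, (U : Y.left.Opens)) ⧸
          (Scheme.IdealSheafData.vanishingIdeal ⟨Z, hZ⟩).ideal U) := by
        rw [← Ideal.isRadical_iff_quotient_reduced, Scheme.IdealSheafData.vanishingIdeal_ideal]
        exact PrimeSpectrum.isRadical_vanishingIdeal _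
      infer_instance
    exact IsReduced.of_openCover _
      (Scheme.IdealSheafData.vanishingIdeal ⟨Z, hZ⟩).subschemeCover.openCover
  · change Set.range (Scheme.IdealSheafData.vanishingIdeal ⟨Z, hZ⟩).subschemeι = Z
    rw [Scheme.IdealSheafData.range_subschemeι, Scheme.IdealSheafData.coe_support_vanishingIdeal]
    rfl

end ClosedSubscheme

/-! ### The Zariski-closed set of `ℙᴺ_ℂ` under a projective algebraic set -/

section Proj

/-- **A projective algebraic set is the trace of a Zariski-closed set.** For a finite set `S` of
homogeneous forms, the Zariski-closed subset `Z = ⋂_{G ∈ S} (ℙᴺ ∖ D₊(G))` of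
`ℙᴺ_ℂ = Proj ℂ[x₀, …, x_N]` satisfies: `p ∈ V(S) ⊆ ℙᴺ(ℂ)` iff the complex point `projPoint p` lies
on `Z` (`projPoint⁻¹(D₊(G)(ℂ)) = ℙᴺ(ℂ) ∖ V(G)`, `preimage_projPoint_setOf_pt_mem_basicOpen`, which
supplies the opens `D₊(G)` of `Proj ℂ[x₀, …, x_N]`). [cite: SerreGAGA1956, §2 n°5 Prop. 2] -/
theorem exists_isClosed_mem_projZeroLocus_iff {N : ℕ} (S : Finset (MvPolynomial (Fin (N + 1)) ℂ))
    (hS : ∀ G ∈ S, G.IsHomogeneous G.totalDegree) :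
    ∃ Z : Set (projectiveSpace N ℂ).left, IsClosed Z ∧
      ∀ p : ℙ ℂ (Fin (N + 1) → ℂ),
        p ∈ projZeroLocus (↑S : Set (MvPolynomial (Fin (N + 1)) ℂ)) ↔ (projPoint N p).pt ∈ Z := by
  -- adapted from `Literature.AlgebraicGeometry.HodgeTheory.chow_analyticSet_analytification_of`
  -- the standard opens `D₊(G)`, `G ∈ S`, with `projPoint⁻¹(D₊(G)(ℂ)) = ℙᴺ(ℂ) ∖ V(G)`
  have key : ∀ G ∈ S, ∃ D : (projectiveSpace N ℂ).left.Opens,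
      projPoint N ⁻¹' {P | P.pt ∈ D} =
        (projZeroLocus ({G} : Set (MvPolynomial (Fin (N + 1)) ℂ)))ᶜ :=
    fun G hG ↦ ⟨_, preimage_projPoint_setOf_pt_mem_basicOpen N G G.totalDegree (hS G hG)⟩
  choose D hD using key
  refine ⟨{y | ∀ (G) (hG : G ∈ S), y ∉ D G hG}, ?_, fun p ↦ ?_⟩
  · have hZ' : {y : (projectiveSpace N ℂ).left | ∀ (G) (hG : G ∈ S), y ∉ D G hG} =
        ⋂ (G) (hG : G ∈ S), {y : (projectiveSpace N ℂ).left | y ∉ D G hG} := by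
      ext y
      simp only [Set.mem_setOf_eq, Set.mem_iInter]
    rw [hZ']
    exact isClosed_iInter fun G ↦ isClosed_iInter fun hG ↦ (D G hG).isOpen.isClosed_compl
  · have hmem : p ∈ projZeroLocus (↑S : Set (MvPolynomial (Fin (N + 1)) ℂ)) ↔
        ∀ G ∈ S, MvPolynomial.eval p.rep G = 0 := by
      simp only [projZeroLocus, Set.mem_setOf_eq, Finset.mem_coe]
    rw [hmem, Set.mem_setOf_eq]
    refine forall₂_congr fun G hG ↦ ?_
    have hp : p ∈ (projZeroLocus ({G} : Set (MvPolynomial (Fin (N + 1)) ℂ)))ᶜ ↔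
        (projPoint N p).pt ∈ D G hG := by
      rw [← hD G hG]
      rfl
    have hsingle : p ∈ projZeroLocus ({G} : Set (MvPolynomial (Fin (N + 1)) ℂ)) ↔
        MvPolynomial.eval p.rep G = 0 := by
      simp only [projZeroLocus, Set.mem_setOf_eq, Set.mem_singleton_iff, forall_eq]
    rw [Set.mem_compl_iff, hsingle] at hp
    tauto

end Proj

/-! ### The analytification of a closed subscheme of `ℙᴺ_ℂ` through which `F` factors -/

section Analytification

variable {n N : ℕ} {M : Type} [TopologicalSpace M] [CompactSpace M] [ChartedSpace (Fin n → ℂ) M]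

/-- **GAGA §2 n°5 for a closed subscheme of `ℙᴺ` parametrised by a compact manifold.** Let
`ι : X ↪ ℙᴺ_ℂ` be a closed `ℂ`-immersion and `F : M → ℙᴺ(ℂ)` an injective holomorphic map on a
compact complex manifold `M` with `ι(ℂ)(X(ℂ)) = projPoint (F(M))`. Then the induced bijection
`φ = ι(ℂ)⁻¹ ∘ projPoint ∘ F : M → X(ℂ)` is an analytification of `X`: it is a homeomorphism (`ι(ℂ)`
is a closed embedding of the compact `X(ℂ)` — `X` is proper — into the Hausdorff `ℙᴺ_ℂ(ℂ)`, and `M`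
is compact, `X(ℂ)` Hausdorff), and regular functions pull back to holomorphic functions: a closed
immersion is surjective on stalks, so a regular function near `φ m₀` is, on the complex points of a
Zariski neighbourhood, the restriction of a regular function `r` on an affine open of `ℙᴺ`, and
`r ∘ projPoint ∘ F` is holomorphic (regular functions on `ℙᴺ` are holomorphic on `ℙᴺ(ℂ)`,
`isAnalytification_projPoint`). «La structure analytique de `Y^h` coïncide avec la structure
analytique induite sur `Y` par `X^h`.» [cite: SerreGAGA1956, §2 n°5 Prop. 2 and p. 9] -/
theorem exists_isAnalytification_of_range_map_eq {X : SchemeOver ℂ} (ι : X ⟶ projectiveSpace N ℂ)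
    [IsClosedImmersion ι.left] (F : M → ℙ ℂ (Fin (N + 1) → ℂ))
    (hF : ContMDiff 𝓘(ℂ, Fin n → ℂ) 𝓘(ℂ, Fin N → ℂ) ω F) (hFinj : Function.Injective F)
    (hrange : Set.range (AlgPoints.map ι : ComplexPoints X → ComplexPoints (projectiveSpace N ℂ)) =
      projPoint N '' Set.range F) :
    ∃ φ : M → ComplexPoints X,
      IsAnalytification (Fin n → ℂ) X n φ ∧ ∀ m, AlgPoints.map ι (φ m) = projPoint N (F m) := by
  -- topology: `X(ℂ)` is compact (`X` is proper), `ℙᴺ_ℂ(ℂ)` is Hausdorff, `ι(ℂ)` is a closed embedding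
  haveI : IsProper X.hom := by rw [← Over.w ι]; infer_instance
  haveI : CompactSpace (ComplexPoints X) := compactSpace_algPoints_of_isProper_holds X ℂ
  haveI : T2Space (ComplexPoints (projectiveSpace N ℂ)) := ComplexPoints.t2Space_of_isSeparated _
  have hιc : Continuous (AlgPoints.map ι : ComplexPoints X → ComplexPoints (projectiveSpace N ℂ)) :=
    AlgPoints.continuous_map ι
  have hιi : Function.Injective
      (AlgPoints.map ι : ComplexPoints X → ComplexPoints (projectiveSpace N ℂ)) :=
    AlgPoints.map_injective ι
  haveI : T2Space (ComplexPoints X) := .of_injective_continuous hιi hιc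
  have hemb : Topology.IsClosedEmbedding
      (AlgPoints.map ι : ComplexPoints X → ComplexPoints (projectiveSpace N ℂ)) :=
    hιc.isClosedEmbedding hιi
  -- the map `φ = ι(ℂ)⁻¹ ∘ projPoint ∘ F`
  have hex : ∀ m, ∃ Q : ComplexPoints X, AlgPoints.map ι Q = projPoint N (F m) := fun m ↦ by
    have hm : projPoint N (F m) ∈
        Set.range (AlgPoints.map ι : ComplexPoints X → ComplexPoints (projectiveSpace N ℂ)) := by
      rw [hrange]
      exact ⟨F m, ⟨m, rfl⟩, rfl⟩
    exact hm
  choose φ hφ using hex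
  have hcompF : AlgPoints.map ι ∘ φ = projPoint N ∘ F := funext hφ
  have hcont : Continuous φ := by
    rw [hemb.isInducing.continuous_iff, hcompF]
    exact (continuous_projPoint N).comp hF.continuous
  have hinj : Function.Injective φ := fun m m' h ↦
    hFinj (projPoint_injective N (by rw [← hφ, ← hφ, h]))
  have hsurj : Function.Surjective φ := fun Q ↦ by
    have hQ : AlgPoints.map ι Q ∈ projPoint N '' Set.range F := by
      rw [← hrange]
      exact ⟨Q, rfl⟩
    obtain ⟨_, ⟨m, rfl⟩, hm⟩ := hQ
    exact ⟨m, hιi (by rw [hφ, hm])⟩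
  have hhomeo : IsHomeomorph φ := isHomeomorph_iff_continuous_bijective.mpr ⟨hcont, hinj, hsurj⟩
  refine ⟨φ, ⟨hhomeo, Module.finrank_fin_fun ℂ, fun U s ↦ ?_⟩, hφ⟩
  -- regular functions on affine opens of `X` pull back to holomorphic functions on `M`
  intro m₀ hm₀
  obtain ⟨O, r, Nz, hNz, hQ⟩ :=
    Literature.AlgebraicGeometry.HodgeTheory.exists_eval_eq_of_stalkMap_surjective ι (φ m₀)
      (ι.left.stalkMap_surjective _) U s hm₀
  -- the local representative `m ↦ r(projPoint (F m))`, holomorphic on `F⁻¹(projPoint⁻¹(O(ℂ)))`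
  set W : Set M :=
    F ⁻¹' (projPoint N ⁻¹' {Q | Q.pt ∈ (↑O : (projectiveSpace N ℂ).left.Opens)}) with hW
  have hWo : IsOpen W :=
    ((AlgPoints.isOpen_setOf_pt_mem _).preimage (continuous_projPoint N)).preimage hF.continuous
  have hg : MDifferentiableOn 𝓘(ℂ, Fin n → ℂ) 𝓘(ℂ, ℂ)
      (fun m ↦ AlgPoints.evalOrZero (↑O : (projectiveSpace N ℂ).left.Opens) r
        (projPoint N (F m))) W :=
    (mdifferentiableOn_evalOrZero_projPoint N _ r).comp
      (hF.mdifferentiable (by simp)).mdifferentiableOn fun m hm ↦ hm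
  have hm₀W : m₀ ∈ W := by
    have h := (hQ (φ m₀) hNz).1
    rw [hφ] at h
    exact h
  have hgat : MDifferentiableAt 𝓘(ℂ, Fin n → ℂ) 𝓘(ℂ, ℂ)
      (fun m ↦ AlgPoints.evalOrZero (↑O : (projectiveSpace N ℂ).left.Opens) r
        (projPoint N (F m))) m₀ :=
    (hg m₀ hm₀W).mdifferentiableAt (hWo.mem_nhds hm₀W)
  -- on the neighbourhood `φ⁻¹(Nz(ℂ))` of `m₀`, `s ∘ φ` is this representative
  have hVo : IsOpen (φ ⁻¹' {Q : ComplexPoints X | Q.pt ∈ Nz}) :=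
    (AlgPoints.isOpen_setOf_pt_mem Nz).preimage hcont
  have heq : (fun m ↦ AlgPoints.evalOrZero (↑U : X.left.Opens) s (φ m)) =ᶠ[𝓝 m₀]
      fun m ↦ AlgPoints.evalOrZero (↑O : (projectiveSpace N ℂ).left.Opens) r
        (projPoint N (F m)) :=
    Filter.eventuallyEq_of_mem (hVo.mem_nhds hNz) fun m hm ↦ by
      rw [← hφ m]
      exact (hQ (φ m) hm).2
  exact (hgat.congr_of_eventuallyEq heq).mdifferentiableWithinAt

end Analytification

/-! ### The registered stub -/

/-- **stub_algebraisation** (the registered stub of the line `birth`, verbatim). Let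
`F : M → ℙᴺ(ℂ)` be injective and holomorphic on a compact complex manifold `M` (model `ℂⁿ`) whose
image is a projective algebraic set (`IsProjAlgebraicSet`, e.g. by Chow's theorem). Then there are a
REDUCED closed subscheme `ι : X ↪ ℙᴺ_ℂ` whose complex points are exactly the image (`X` is the
reduced induced structure on the Zariski-closed set `⋂_{G ∈ S} (ℙᴺ ∖ D₊(G))` under `V(S) = F(M)`,
Mathlib `Scheme.IdealSheafData.vanishingIdeal … |>.subscheme`; Hartshorne II Example 3.2.6,
Ex. 3.11 (d)) and a map `φ : M → X(ℂ)` over `F` (`ι(ℂ) ∘ φ = projPoint ∘ F`) which IS an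
analytification of `X`: a homeomorphism (all maps are closed embeddings of compacta) along which
regular functions on affine opens pull back to holomorphic functions (a closed immersion is
surjective on stalks, so a regular germ on `X` is the restriction of a regular germ on `ℙᴺ`,
holomorphic along `projPoint` by `isAnalytification_projPoint`, then compose with `F`).
[cite: SerreGAGA1956, §2 n°5 Prop. 2 and p. 9] [cite: Hartshorne1977, II Example 3.2.6 and II Ex. 3.11 (d)] -/
theorem stub_algebraisation :
    ∀ ⦃n N : ℕ⦄ ⦃M : Type⦄ [TopologicalSpace M] [T2Space M] [CompactSpace M]
      [ChartedSpace (Fin n → ℂ) M] [IsManifold 𝓘(ℂ, Fin n → ℂ) ω M]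
      (F : M → ℙ ℂ (Fin (N + 1) → ℂ)),
      ContMDiff 𝓘(ℂ, Fin n → ℂ) 𝓘(ℂ, Fin N → ℂ) ω F → Function.Injective F →
      IsProjAlgebraicSet (Set.range F) →
      ∃ (X : SchemeOver ℂ) (ι : X ⟶ projectiveSpace N ℂ) (_ : IsClosedImmersion ι.left)
        (_ : IsReduced X.left) (φ : M → ComplexPoints X),
        IsAnalytification (Fin n → ℂ) X n φ ∧ ∀ m, AlgPoints.map ι (φ m) = projPoint N (F m) := by
  intro n N M _ _ _ _ _ F hF hFinj hAlg
  -- `range F = V(S)` and the Zariski-closed set `Z` under it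
  obtain ⟨S, hS, hSeq⟩ := hAlg
  obtain ⟨Z, hZc, hZ⟩ := exists_isClosed_mem_projZeroLocus_iff S hS
  -- the reduced induced closed subscheme on `Z`
  obtain ⟨X, ι, hι, hred, hrangeι⟩ :=
    exists_isClosedImmersion_isReduced_range_eq (projectiveSpace N ℂ) hZc
  haveI := hι
  -- its complex points are `projPoint (F(M))`
  have hrange : Set.range
      (AlgPoints.map ι : ComplexPoints X → ComplexPoints (projectiveSpace N ℂ)) =
      projPoint N '' Set.range F := by
    rw [range_map_of_isClosedImmersion ι, hrangeι, hSeq]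
    ext Q
    constructor
    · intro hQ
      obtain ⟨p, rfl⟩ := projPoint_surjective N Q
      exact ⟨p, (hZ p).mpr hQ, rfl⟩
    · rintro ⟨p, hp, rfl⟩
      exact (hZ p).mp hp
  -- the analytification
  obtain ⟨φ, hφ, hcomp⟩ := exists_isAnalytification_of_range_map_eq ι F hF hFinj hrange
  exact ⟨X, ι, hι, hred, φ, hφ, hcomp⟩

end Summit.HodgeConjecture.HodgeConjecture.Theorems.RiemannWeightOne

end
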